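import Mathlib
import HarnessLib
import Summits.Ventures.LatticeQCDFlow.Scaling.Wilson2DU1PlaquetteDensity

/-!
# LatticeQCDFlow / Scaling — `U(1)`: the first convolution power `K_w w` of the Wilson weight is
# STRICTLY larger at the identity than at `−1`; the domino density `(K_w w)·(K_wᵐ w)` is not a.e. constant

HONEST FRAMING: exact (Metropolis-corrected) sampling algorithms for lattice gauge theory;
figures of merit are autocorrelation/cost numbers at stated couplings and volumes; no
continuum-physics claim.

Venture `LatticeQCDFlow` (cell pub-lqcd), topic `Scaling`, FANOUT row 30 (lean-1, GEN-18) — OUR WORK, the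
analytic input of the two-plaquette ("domino") step of THEORY-2 §4 row C5 in the gauge case
(`Scaling/Wilson2DU1DominoDensity`, `Scaling/AutoregressiveGaugeDominoReads`).  With
`w = w_β(g) = e^{−β(1 − Re g)}` the one-plaquette `U(1)` Wilson weight and `K_w` the Haar convolution
operator of `Scaling/HaarConvolutionRatio` (`(K_w φ)(u) = ∫ φ(ug) w(g) dg`):

* §1 **`haarConv_u1W_self_neg_one`** — `(K_w w)(−1) = e^{−2β}` exactly (`w(−g)·w(g) = e^{−2β}` for
  every `g`); **`toReal_haarConv_u1W_self_one`** — `(K_w w)(1) = ∫ e^{−2β(1 − Re g)} dg`;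
  **`exp_neg_two_mul_lt_haarConv_u1W_self_one`** — for `β > 0`, `e^{−2β} < (K_w w)(1)`: symmetrising
  under `g ↦ −g` (left invariance of Haar) the integrand becomes `e^{−2β}·cosh(2β Re g) ≥ e^{−2β}`, with
  strict inequality on the open set `{Re g ≠ 0} ∋ 1`, which Haar measure charges; hence
  **`haarConv_u1W_self_neg_one_lt_one`**: `(K_w w)(−1) < (K_w w)(1)`.
* §2 **`u1_dominoDensity_lt`** — `(K_w w)(−1)·(K_wᵐ w)(−1) < (K_w w)(1)·(K_wᵐ w)(1)` for every `m`
  (the second factor peaks at `1` by `Scaling/U1ConvolutionPowerPeak`); **`continuous_u1_dominoDensity`**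
  and **`u1_dominoDensity_not_ae_const`** — `D_m = ((K_w w)·(K_wᵐ w)).toReal` is continuous and, for
  `β > 0`, not a.e. equal to any constant.  With `m = L² − 3`, `D_m dHaar/Z` is the law of the holonomy
  around two adjacent plaquettes of the two-dimensional `U(1)` Wilson measure on `(ℤ/L)²` (the sequel).

Elementary over the parents; no `def`; nothing is cited as a fact; no `sorry`.
-/

noncomputable section

namespace Summit.Ventures.LatticeQCDFlow.Theory2.HaarConv

open MeasureTheory Function Set
open Literature.MathematicalPhysics.QuantumFieldTheory Literature.MathematicalPhysics.QuantumLattice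
open Summit.Ventures.LatticeQCDFlow.Theory2.Lattice.TwoDim (measurable_circle_re abs_circle_re_le_one)
open Summit.Ventures.LatticeQCDFlow.Theory2.Autoregressive (continuous_u1_iterate_toReal)
open scoped ENNReal

variable (β : ℝ)

/-! ## §1 `(K_w w)(−1) = e^{−2β} < (K_w w)(1)` -/

/-- The real form of the weight: `(w_β g).toReal = e^{−β(1 − Re g)}`. [ours] -/
theorem toReal_u1W (g : Circle) : (u1W β g).toReal = Real.exp (-(β * (1 - ((g : Circle) : ℂ).re))) := by
  rw [u1W_apply, ENNReal.toReal_ofReal (Real.exp_pos _).le]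

/-- `w(−g)·w(g) = e^{−2β}`: the exponents `−β(1 + Re g)` and `−β(1 − Re g)` add up to `−2β`. [ours] -/
theorem u1W_neg_mul_self (g : Circle) :
    u1W β (-1 * g) * u1W β g = ENNReal.ofReal (Real.exp (-(2 * β))) := by
  rw [u1W_apply, u1W_apply, ← ENNReal.ofReal_mul (Real.exp_pos _).le, ← Real.exp_add]
  congr 1
  simp only [neg_one_mul, Circle.coe_neg, Complex.neg_re]
  ring

/-- **`(K_w w)(−1) = e^{−2β}`** exactly. [ours] -/
theorem haarConv_u1W_self_neg_one :
    haarConv (u1W β) (u1W β) (-1) = ENNReal.ofReal (Real.exp (-(2 * β))) := by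
  unfold haarConv
  simp_rw [u1W_neg_mul_self β]
  rw [lintegral_const, measure_univ, mul_one]

/-- **`(K_w w)(1) = ∫ e^{−2β(1 − Re g)} dg`** (real form). [ours] -/
theorem toReal_haarConv_u1W_self_one :
    (haarConv (u1W β) (u1W β) 1).toReal =
      ∫ g, Real.exp (-(2 * β * (1 - ((g : Circle) : ℂ).re))) ∂(haarProbability Circle) := by
  unfold haarConv
  simp only [one_mul]
  have hpt : ∀ g : Circle, u1W β g * u1W β g =
      ENNReal.ofReal (Real.exp (-(2 * β * (1 - ((g : Circle) : ℂ).re)))) := by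
    intro g
    rw [u1W_apply, ← ENNReal.ofReal_mul (Real.exp_pos _).le, ← Real.exp_add]
    congr 1; ring
  simp_rw [hpt]
  have hc : Continuous fun g : Circle => Real.exp (-(2 * β * (1 - ((g : Circle) : ℂ).re))) := by
    fun_prop
  have hi : Integrable (fun g : Circle => Real.exp (-(2 * β * (1 - ((g : Circle) : ℂ).re))))
      (haarProbability Circle) := by
    refine Integrable.mono' (integrable_const (Real.exp (|2 * β| * 2))) hc.measurable.aestronglyMeasurable
      (ae_of_all _ fun g => ?_)
    rw [Real.norm_eq_abs, abs_of_pos (Real.exp_pos _)]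
    refine Real.exp_le_exp.2 ?_
    have h1 := abs_circle_re_le_one g
    have h2 : |1 - ((g : Circle) : ℂ).re| ≤ 2 := by
      have := abs_le.1 h1; rw [abs_le]; constructor <;> linarith
    calc -(2 * β * (1 - ((g : Circle) : ℂ).re)) ≤ |2 * β * (1 - ((g : Circle) : ℂ).re)| := neg_le_abs _
      _ = |2 * β| * |1 - ((g : Circle) : ℂ).re| := abs_mul _ _
      _ ≤ |2 * β| * 2 := mul_le_mul_of_nonneg_left h2 (abs_nonneg _)
  rw [← ofReal_integral_eq_lintegral_ofReal hi (ae_of_all _ fun g => (Real.exp_pos _).le),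
    ENNReal.toReal_ofReal (integral_nonneg fun g => (Real.exp_pos _).le)]

/-- **`e^{−2β} < (K_w w)(1)` for `β > 0`.**  Symmetrise under `g ↦ −g`: the integrand of
`toReal_haarConv_u1W_self_one` has the same integral as its reflection, so
`(K_w w)(1) = ∫ e^{−2β} cosh(2β Re g) dg`; `cosh ≥ 1` everywhere and `cosh(2β Re g) > 1` on the open
set `{Re g ≠ 0}`, which contains `1` and is charged by Haar measure. [ours] -/
theorem exp_neg_two_mul_lt_haarConv_u1W_self_one {β : ℝ} (hβ : 0 < β) :
    ENNReal.ofReal (Real.exp (-(2 * β))) < haarConv (u1W β) (u1W β) 1 := by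
  set μ := haarProbability Circle with hμ
  have hne : haarConv (u1W β) (u1W β) 1 ≠ ⊤ := by
    refine ne_top_of_le_ne_top ENNReal.one_ne_top ?_
    have h := iterate_apply_le_one (measurable_u1W β) (u1W_le_one hβ.le) 1 1
    rwa [Function.iterate_one] at h
  rw [← ENNReal.ofReal_toReal hne, ENNReal.ofReal_lt_ofReal_iff_of_nonneg (Real.exp_pos _).le,
    toReal_haarConv_u1W_self_one]
  -- names
  set r : Circle → ℝ := fun g => ((g : Circle) : ℂ).re with hr
  have hrc : Continuous r := Complex.continuous_re.comp continuous_subtype_val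
  set F : Circle → ℝ := fun g => Real.exp (-(2 * β * (1 - r g))) with hF
  have hFc : Continuous F := by simp only [hF]; fun_prop
  have hFb : ∀ g, |F g| ≤ Real.exp (4 * β) := by
    intro g
    rw [abs_of_pos (Real.exp_pos _)]
    refine Real.exp_le_exp.2 ?_
    have := abs_le.1 (abs_circle_re_le_one g)
    simp only [hr] at this ⊢
    nlinarith
  have hFi : Integrable F μ := Integrable.mono' (integrable_const _) hFc.measurable.aestronglyMeasurable
    (ae_of_all _ fun g => by rw [Real.norm_eq_abs]; exact hFb g)
  -- reflection: `∫ F(−g) = ∫ F(g)`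
  have hrefl : ∫ g, F (-1 * g) ∂μ = ∫ g, F g ∂μ := integral_mul_left_eq_self F (-1 : Circle)
  have hFneg : ∀ g, F (-1 * g) = Real.exp (-(2 * β * (1 + r g))) := by
    intro g
    simp only [hF, hr, neg_one_mul, Circle.coe_neg, Complex.neg_re, sub_neg_eq_add]
  -- the symmetrised integrand
  set H : Circle → ℝ := fun g => Real.exp (-(2 * β)) * (Real.cosh (2 * β * r g) - 1) with hH
  have hHc : Continuous H := by simp only [hH]; fun_prop
  have hsum : ∀ g, F g + F (-1 * g) = 2 * Real.exp (-(2 * β)) + 2 * H g := by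
    intro g
    rw [hFneg]
    simp only [hF, hH, Real.cosh_eq]
    have e1 : Real.exp (-(2 * β * (1 - r g))) = Real.exp (-(2 * β)) * Real.exp (2 * β * r g) := by
      rw [← Real.exp_add]; congr 1; ring
    have e2 : Real.exp (-(2 * β * (1 + r g))) = Real.exp (-(2 * β)) * Real.exp (-(2 * β * r g)) := by
      rw [← Real.exp_add]; congr 1; ring
    rw [e1, e2]
    ring
  have hH0 : ∀ g, 0 ≤ H g := fun g =>
    mul_nonneg (Real.exp_pos _).le (sub_nonneg.2 (Real.one_le_cosh _))
  have hHi : Integrable H μ := by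
    have h2 : Integrable (fun g => F g + F (-1 * g)) μ :=
      hFi.add (hFi.comp_mul_left (-1 : Circle))
    have h3 : Integrable (fun g => (F g + F (-1 * g) - 2 * Real.exp (-(2 * β))) / 2) μ :=
      (h2.sub (integrable_const _)).div_const 2
    refine h3.congr (ae_of_all _ fun g => ?_)
    simp only [hsum]; ring
  -- `∫ F = e^{−2β} + ∫ H`
  have hint : ∫ g, F g ∂μ = Real.exp (-(2 * β)) + ∫ g, H g ∂μ := by
    have h2 : ∫ g, (F g + F (-1 * g)) ∂μ = 2 * ∫ g, F g ∂μ := by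
      rw [integral_add hFi (hFi.comp_mul_left (-1 : Circle)), hrefl]; ring
    have h3 : ∫ g, (F g + F (-1 * g)) ∂μ = 2 * Real.exp (-(2 * β)) + 2 * ∫ g, H g ∂μ := by
      simp_rw [hsum]
      rw [integral_add (integrable_const _) (hHi.const_mul 2), integral_const, integral_const_mul]
      simp [Measure.real, hμ]
    linarith
  rw [hint, lt_add_iff_pos_right]
  -- `∫ H > 0`: `H ≥ 0`, continuous, `H 1 > 0`, Haar charges open sets
  rw [integral_pos_iff_support_of_nonneg hH0 hHi]
  have hopen : IsOpen (support H) := hHc.isOpen_support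
  have h1 : (1 : Circle) ∈ support H := by
    rw [mem_support]
    simp only [hH, hr, Circle.coe_one, Complex.one_re, mul_one]
    have hc : 1 < Real.cosh (2 * β) := Real.one_lt_cosh.2 (by positivity)
    exact mul_ne_zero (Real.exp_pos _).ne' (by linarith)
  exact hopen.measure_pos μ ⟨1, h1⟩

/-- **`(K_w w)(−1) < (K_w w)(1)`** for `β > 0`: the first convolution power of the `U(1)` Wilson weight
is strictly smaller at `−1` than at the identity. [ours] -/
theorem haarConv_u1W_self_neg_one_lt_one {β : ℝ} (hβ : 0 < β) :
    haarConv (u1W β) (u1W β) (-1) < haarConv (u1W β) (u1W β) 1 := by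
  rw [haarConv_u1W_self_neg_one]
  exact exp_neg_two_mul_lt_haarConv_u1W_self_one hβ

/-! ## §2 The domino density `(K_w w)·(K_wᵐ w)`: strictly larger at `1` than at `−1`, continuous,
not a.e. constant -/

/-- **STRICTNESS OF THE DOMINO DENSITY**: `(K_w w)(−1)·(K_wᵐ w)(−1) < (K_w w)(1)·(K_wᵐ w)(1)` for `β > 0`
and every `m` (`K_wᵐ w` peaks at the identity, `Scaling/U1ConvolutionPowerPeak`; `K_w w` strictly,
§1). [ours] -/
theorem u1_dominoDensity_lt {β : ℝ} (hβ : 0 < β) (m : ℕ) :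
    haarConv (u1W β) (u1W β) (-1) * (haarConv (u1W β))^[m] (u1W β) (-1) <
      haarConv (u1W β) (u1W β) 1 * (haarConv (u1W β))^[m] (u1W β) 1 := by
  have hne : (haarConv (u1W β))^[m] (u1W β) 1 ≠ 0 :=
    iterate_apply_ne_zero (measurable_u1W β) (u1W_ne_zero β) m 1
  have hnt : (haarConv (u1W β))^[m] (u1W β) 1 ≠ ⊤ :=
    ne_top_of_le_ne_top ENNReal.one_ne_top
      (iterate_apply_le_one (measurable_u1W β) (u1W_le_one hβ.le) m 1)
  calc haarConv (u1W β) (u1W β) (-1) * (haarConv (u1W β))^[m] (u1W β) (-1)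
      ≤ haarConv (u1W β) (u1W β) (-1) * (haarConv (u1W β))^[m] (u1W β) 1 := by
        gcongr; exact u1_iterate_apply_le_apply_one hβ.le m (-1)
    _ < haarConv (u1W β) (u1W β) 1 * (haarConv (u1W β))^[m] (u1W β) 1 :=
        ENNReal.mul_lt_mul_left hne hnt (haarConv_u1W_self_neg_one_lt_one hβ)

/-- **The domino density is continuous** (`β ≥ 0`): both factors are continuous convolution powers
(`Scaling/Wilson2DU1PlaquetteDensity.continuous_u1_iterate_toReal`). [ours] -/
theorem continuous_u1_dominoDensity (hβ : 0 ≤ β) (m : ℕ) :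
    Continuous fun g : Circle =>
      (haarConv (u1W β) (u1W β) g * (haarConv (u1W β))^[m] (u1W β) g).toReal := by
  have h1 : ∀ g : Circle, (haarConv (u1W β) (u1W β) g * (haarConv (u1W β))^[m] (u1W β) g).toReal =
      ((haarConv (u1W β))^[1] (u1W β) g).toReal * ((haarConv (u1W β))^[m] (u1W β) g).toReal := by
    intro g; rw [ENNReal.toReal_mul, Function.iterate_one]
  simp_rw [h1]
  exact (continuous_u1_iterate_toReal β hβ 1).mul (continuous_u1_iterate_toReal β hβ m)

/-- **The domino density is NOT a.e. constant** (`β > 0`, any `m`): it is continuous, strictly larger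
at `1` than at `−1`, and Haar measure charges open sets. [ours] -/
theorem u1_dominoDensity_not_ae_const {β : ℝ} (hβ : 0 < β) (m : ℕ) (κ : ℝ) :
    ¬ ((fun g : Circle =>
        (haarConv (u1W β) (u1W β) g * (haarConv (u1W β))^[m] (u1W β) g).toReal) =ᵐ[haarProbability Circle]
      fun _ => κ) := by
  intro h
  have heq := (Continuous.ae_eq_iff_eq (haarProbability Circle) (continuous_u1_dominoDensity β hβ.le m)
    continuous_const).1 h
  have hlt := u1_dominoDensity_lt hβ m
  have hne1 : haarConv (u1W β) (u1W β) 1 * (haarConv (u1W β))^[m] (u1W β) 1 ≠ ⊤ := by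
    refine ne_top_of_le_ne_top ENNReal.one_ne_top (mul_le_one' ?_
      (iterate_apply_le_one (measurable_u1W β) (u1W_le_one hβ.le) m 1))
    have h := iterate_apply_le_one (measurable_u1W β) (u1W_le_one hβ.le) 1 1
    rwa [Function.iterate_one] at h
  have h1 := congrFun heq (-1)
  have h2 := congrFun heq 1
  have := ENNReal.toReal_strict_mono hne1 hlt
  rw [h1, h2] at this
  exact lt_irrefl _ this

end Summit.Ventures.LatticeQCDFlow.Theory2.HaarConv

end
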